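import Summits.CriticalPhenomena.PercolationContinuityZ3.Theorems.PercNearOneGluingNoHeavyPcintPriceLawEngine
import Summits.CriticalPhenomena.PercolationContinuityZ3.Theorems.PercNearOneGluingNoHeavyPcintPriceLawFamily
import Literature.Probability.RandomPlanarGeometry.SAWBridgePatternRatio
import Literature.Probability.RandomPlanarGeometry.SAWPositiveWalks
import HarnessLib

/-!
# CriticalPhenomena/PercolationContinuityZ3 — Theorems/PercNearOneGluingNoHeavyPcintPriceLawInputs.lean:
# Kesten's inequality for the near family (the pattern-theorem inputs, then the graded engine)

Lane prim-pcint, STRUCTURE conjecture **C3 (i) PRICE LAW**.  For the graded near family `nearFam d k` (memory `2k` on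
`ℤ^{d+2}`, `…PcintPriceLawFamily.lean`) this file supplies the two inputs of the graded engine
(`kesten_ineq_graded`, `…PcintPriceLawEngine.lean`) and concludes Kesten's inequality
`ψ_k² − D/k ≤ ψ_k ψ_{k+1}` eventually, `ψ_k = |nearFam d (k+1)|/|nearFam d k|` (`nearFam_kesten_ineq`):
* the `Ξ`-input: members with fewer than `k/(2q)` occurrences of `(V,Q)` are at most `C|nearFam d k|/k³` — the short members
  (length `< k`) are few by the Hammersley–Welsh bound against the polygon lower envelope (`Σ_{m<k} c_m ≲ μ^k ≪ μ^{2k}`), the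
  long ones by Kesten's pattern theorem (`SAW.Zd.thm723`: `≤ ((1−ε)μ)^m`);
* the `S_N`-term: `3|nearFam d (k+1)|·#{J = 0}/|nearFam d k|² ≤ C'/k` eventually, by the same two estimates and the envelopes
  `e^{-c√k} μ^{2k} ≤ |nearFam d k| ≤ e^{15√k} μ^{2k}`.
Polynomial factors are absorbed by `k ≤ e^{2√k}`; the decay constants come from `SAW.Zd.decay_bound`.

Source: N. Madras, G. Slade, *The Self-Avoiding Walk* (1993), Theorem 7.2.3, proof of Theorem 7.3.2 ((7.3.11)–(7.3.12))
[MadrasSlade1993].  Written by prim-pcint-2 gen 14 (prover-prim-pcint-2-g14-0), 2026-08-23.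
-/

noncomputable section

open Filter Topology Literature.Probability.LatticeModels
open Literature.Probability.RandomPlanarGeometry.SAW.Zd
open scoped BigOperators

namespace Summit.CriticalPhenomena.PercolationContinuityZ3.Theorems.Pcint.MemoryTail

variable {d : ℕ}

/-! ### Absorbing polynomial factors: `k ≤ e^{2√k}` -/

/-- `x ≤ e^{2√x}` for `x ≥ 0` (`log x = 2 log √x ≤ 2(√x − 1)`). [folklore] -/
theorem le_exp_two_mul_sqrt {x : ℝ} (hx : 0 ≤ x) : x ≤ Real.exp (2 * Real.sqrt x) := by
  rcases hx.eq_or_lt with h | h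
  · rw [← h]; positivity
  · have hs : 0 < Real.sqrt x := Real.sqrt_pos.2 h
    have h1 : Real.log (Real.sqrt x) ≤ Real.sqrt x - 1 := Real.log_le_sub_one_of_pos hs
    have h2 : Real.log x = 2 * Real.log (Real.sqrt x) := by
      rw [Real.log_sqrt hx]; ring
    calc x = Real.exp (Real.log x) := (Real.exp_log h).symm
      _ ≤ Real.exp (2 * Real.sqrt x) := Real.exp_le_exp.2 (by rw [h2]; linarith)

/-- `k^p ≤ e^{2p√k}`. [folklore] -/
theorem natCast_pow_le_exp (k p : ℕ) : (k : ℝ) ^ p ≤ Real.exp (2 * p * Real.sqrt k) := by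
  calc (k : ℝ) ^ p ≤ Real.exp (2 * Real.sqrt k) ^ p :=
        pow_le_pow_left₀ (Nat.cast_nonneg _) (le_exp_two_mul_sqrt (Nat.cast_nonneg _)) p
    _ = Real.exp (2 * p * Real.sqrt k) := by rw [← Real.exp_nat_mul]; ring_nf

/-! ### Envelopes in exponential shape -/

/-- **Upper envelope**: `|nearFam d k| ≤ e^{15√k} μ^{2k}` (`(2k)² e^{6√(2k)} ≤ e^{(4√2+6√2)√k} ≤ e^{15√k}`).
[cite: MadrasSlade1993, §3.1, Theorem 3.1.1] -/
theorem card_nearFam_le_exp (d k : ℕ) :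
    ((nearFam d k).card : ℝ) ≤ Real.exp (15 * Real.sqrt k) * connectiveConstant (d + 2) ^ (2 * k) := by
  have h := card_nearFam_le d k
  have hμ : 0 ≤ connectiveConstant (d + 2) ^ (2 * k) := pow_nonneg (connectiveConstant_pos (d + 2)).le _
  refine h.trans (mul_le_mul_of_nonneg_right ?_ hμ)
  have hsq : Real.sqrt ((2 * k : ℕ) : ℝ) = Real.sqrt 2 * Real.sqrt k := by
    push_cast; exact Real.sqrt_mul (by norm_num) _
  have h2 : Real.sqrt 2 ≤ 3 / 2 := by
    rw [Real.sqrt_le_left (by norm_num)]; norm_num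
  have hs0 : 0 ≤ Real.sqrt (k : ℝ) := Real.sqrt_nonneg _
  calc (((2 * k : ℕ) : ℝ)) ^ 2 * Real.exp (6 * Real.sqrt ((2 * k : ℕ) : ℝ))
      ≤ Real.exp (2 * (2 : ℕ) * Real.sqrt ((2 * k : ℕ) : ℝ)) * Real.exp (6 * Real.sqrt ((2 * k : ℕ) : ℝ)) :=
        mul_le_mul_of_nonneg_right (natCast_pow_le_exp (2 * k) 2) (Real.exp_pos _).le
    _ = Real.exp (10 * Real.sqrt 2 * Real.sqrt k) := by rw [← Real.exp_add, hsq]; push_cast; ring_nf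
    _ ≤ Real.exp (15 * Real.sqrt k) := Real.exp_le_exp.2 (by nlinarith)

/-! ### The few-pattern members -/

/-- **Counting the members poor in `(V,Q)`**: with `q, ε, N₀` from Kesten's pattern theorem (`thm723`), for `k ≥ N₀` the members
`(m, ω)` of `nearFam d k` with `J(ω) < k/(2q)` number at most `Σ_{m<k} c_m + Σ_{k ≤ m < 2k} ((1−ε)μ)^m` (short members are not
controlled; a long member has `J < m/(2q)`, hence `J ≤ ⌊m/q⌋`). [cite: MadrasSlade1993, Theorem 7.2.3 and (7.3.12)] -/
theorem card_poor_le {q N₀ k : ℕ} (hq : 0 < q) {ε : ℝ}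
    (hN₀ : ∀ N, N₀ ≤ N → ((((saws (d + 2) N).filter fun ω => vCount N ω ≤ N / q).card : ℝ)) ≤
      ((1 - ε) * connectiveConstant (d + 2)) ^ N)
    (hk : N₀ ≤ k) :
    ((((nearFam d k).filter fun p => (vCount p.1 p.2 : ℝ) < 1 / (2 * q) * k).card : ℝ)) ≤
      (∑ m ∈ Finset.range k, (count (d + 2) m : ℝ)) +
        ∑ m ∈ Finset.Ico k (2 * k), ((1 - ε) * connectiveConstant (d + 2)) ^ m := by
  classical
  set T := (nearFam d k).filter fun p => (vCount p.1 p.2 : ℝ) < 1 / (2 * q) * k with hT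
  have hq0 : (0 : ℝ) < q := by exact_mod_cast hq
  -- split by length
  have hsplit : (T.card : ℝ) = ((T.filter fun p => p.1 < k).card : ℝ) + ((T.filter fun p => ¬ p.1 < k).card : ℝ) := by
    exact_mod_cast (Finset.card_filter_add_card_filter_not (s := T) (fun p => p.1 < k)).symm
  -- short members: inject into `Σ_{m<k} S_m`
  have hA : ((T.filter fun p => p.1 < k).card : ℝ) ≤ ∑ m ∈ Finset.range k, (count (d + 2) m : ℝ) := by
    have hsub : (T.filter fun p => p.1 < k) ⊆ ((Finset.range k).sigma fun m => saws (d + 2) m).map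
        (Equiv.sigmaEquivProd ℕ (ℕ → Site (d + 2))).toEmbedding := by
      intro p hp
      rw [Finset.mem_filter, hT, Finset.mem_filter] at hp
      rw [Finset.mem_map]
      refine ⟨⟨p.1, p.2⟩, Finset.mem_sigma.2 ⟨Finset.mem_range.2 hp.2, mem_saws_of_mem_nearFam hp.1.1⟩, rfl⟩
    have := Finset.card_le_card hsub
    rw [Finset.card_map, Finset.card_sigma] at this
    calc ((T.filter fun p => p.1 < k).card : ℝ) ≤ ((∑ m ∈ Finset.range k, (saws (d + 2) m).card : ℕ) : ℝ) := by
          exact_mod_cast this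
      _ = ∑ m ∈ Finset.range k, (count (d + 2) m : ℝ) := by
          push_cast
          exact Finset.sum_congr rfl fun m _ => by rw [card_saws]
  -- long members: inject into `Σ_{k ≤ m < 2k} {ω ∈ S_m : J < m/(2q)}`
  have hB : ((T.filter fun p => ¬ p.1 < k).card : ℝ) ≤
      ∑ m ∈ Finset.Ico k (2 * k), ((1 - ε) * connectiveConstant (d + 2)) ^ m := by
    have hsub : (T.filter fun p => ¬ p.1 < k) ⊆ ((Finset.Ico k (2 * k)).sigma fun m =>
        (saws (d + 2) m).filter fun ω => (vCount m ω : ℝ) < 1 / (2 * q) * m).map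
        (Equiv.sigmaEquivProd ℕ (ℕ → Site (d + 2))).toEmbedding := by
      intro p hp
      rw [Finset.mem_filter, hT, Finset.mem_filter] at hp
      obtain ⟨⟨hmem, hJ⟩, hge⟩ := hp
      push Not at hge
      rw [Finset.mem_map]
      refine ⟨⟨p.1, p.2⟩, Finset.mem_sigma.2 ⟨Finset.mem_Ico.2 ⟨hge, ?_⟩, Finset.mem_filter.2
        ⟨mem_saws_of_mem_nearFam hmem, ?_⟩⟩, rfl⟩
      · exact (show p.1 < 2 * k from by have := length_lt_of_mem_nearFam hmem; omega)
      · refine lt_of_lt_of_le hJ (mul_le_mul_of_nonneg_left (by exact_mod_cast hge) (by positivity))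
    have h1 := Finset.card_le_card hsub
    rw [Finset.card_map, Finset.card_sigma] at h1
    calc ((T.filter fun p => ¬ p.1 < k).card : ℝ)
        ≤ ((∑ m ∈ Finset.Ico k (2 * k), ((saws (d + 2) m).filter fun ω => (vCount m ω : ℝ) < 1 / (2 * q) * m).card : ℕ) : ℝ) := by
          exact_mod_cast h1
      _ ≤ ∑ m ∈ Finset.Ico k (2 * k), ((1 - ε) * connectiveConstant (d + 2)) ^ m := by
          push_cast
          refine Finset.sum_le_sum fun m hm => ?_
          have hmk : k ≤ m := (Finset.mem_Ico.1 hm).1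
          refine le_trans ?_ (hN₀ m (le_trans hk hmk))
          exact_mod_cast Finset.card_le_card (filter_vCount_lt_subset hq (saws (d + 2) m) m)
  rw [hsplit]
  exact add_le_add hA hB

/-- The few-pattern count in exponential shape: for `k ≥ max N₀ 1`,
`#{J < k/(2q)} ≤ e^{10√k} (μ^k + (1−ε)^k μ^{2k})`. [cite: MadrasSlade1993, Theorem 7.2.3 and (7.3.12)] -/
theorem card_poor_le_exp {q N₀ k : ℕ} (hq : 0 < q) {ε : ℝ} (hε0 : 0 < ε) (hε1 : ε < 1)
    (hN₀ : ∀ N, N₀ ≤ N → ((((saws (d + 2) N).filter fun ω => vCount N ω ≤ N / q).card : ℝ)) ≤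
      ((1 - ε) * connectiveConstant (d + 2)) ^ N)
    (hk : N₀ ≤ k) (hk1 : 1 ≤ k) :
    ((((nearFam d k).filter fun p => (vCount p.1 p.2 : ℝ) < 1 / (2 * q) * k).card : ℝ)) ≤
      Real.exp (10 * Real.sqrt k) *
        (connectiveConstant (d + 2) ^ k + (1 - ε) ^ k * connectiveConstant (d + 2) ^ (2 * k)) := by
  set μ := connectiveConstant (d + 2) with hμ
  have hμ1 : 1 ≤ μ := one_le_connectiveConstant (d + 2)
  have hμ0 : 0 < μ := by linarith
  have hs0 : 0 ≤ Real.sqrt (k : ℝ) := Real.sqrt_nonneg _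
  refine (card_poor_le hq hN₀ hk).trans ?_
  -- `Σ_{m<k} c_m ≤ k · k e^{6√k} μ^k ≤ e^{4√k} e^{6√k} μ^k`
  have hA : ∑ m ∈ Finset.range k, (count (d + 2) m : ℝ) ≤ Real.exp (10 * Real.sqrt k) * μ ^ k := by
    have h1 : ∀ m ∈ Finset.range k, (count (d + 2) m : ℝ) ≤ k * Real.exp (6 * Real.sqrt k) * μ ^ k := fun m hm =>
      count_le_envelope (by have := Finset.mem_range.1 hm; omega)
    refine (Finset.sum_le_sum h1).trans ?_
    rw [Finset.sum_const, Finset.card_range, nsmul_eq_mul]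
    have hk2 : (k : ℝ) * k ≤ Real.exp (4 * Real.sqrt k) := by
      have := natCast_pow_le_exp k 2
      rw [pow_two] at this
      refine this.trans (le_of_eq ?_)
      norm_num
    calc (k : ℝ) * (k * Real.exp (6 * Real.sqrt k) * μ ^ k) = (k * k) * Real.exp (6 * Real.sqrt k) * μ ^ k := by ring
      _ ≤ Real.exp (4 * Real.sqrt k) * Real.exp (6 * Real.sqrt k) * μ ^ k := by gcongr
      _ = Real.exp (10 * Real.sqrt k) * μ ^ k := by rw [← Real.exp_add]; ring_nf
  -- `Σ_{k≤m<2k} ((1-ε)μ)^m ≤ k (1-ε)^k μ^{2k} ≤ e^{2√k} (1-ε)^k μ^{2k}`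
  have hB : ∑ m ∈ Finset.Ico k (2 * k), ((1 - ε) * μ) ^ m ≤ Real.exp (10 * Real.sqrt k) * ((1 - ε) ^ k * μ ^ (2 * k)) := by
    have h1 : ∀ m ∈ Finset.Ico k (2 * k), ((1 - ε) * μ) ^ m ≤ (1 - ε) ^ k * μ ^ (2 * k) := by
      intro m hm
      obtain ⟨hkm, hm2⟩ := Finset.mem_Ico.1 hm
      rw [mul_pow]
      exact mul_le_mul (pow_le_pow_of_le_one (by linarith) (by linarith) hkm)
        (pow_le_pow_right₀ hμ1 hm2.le) (by positivity) (pow_nonneg (by linarith) _)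
    refine (Finset.sum_le_sum h1).trans ?_
    rw [Finset.sum_const, Nat.card_Ico, nsmul_eq_mul, show 2 * k - k = k by omega]
    have hk2 : (k : ℝ) ≤ Real.exp (10 * Real.sqrt k) :=
      (le_exp_two_mul_sqrt (Nat.cast_nonneg k)).trans (Real.exp_le_exp.2 (by nlinarith))
    exact mul_le_mul_of_nonneg_right hk2 (by positivity)
  rw [mul_add]
  exact add_le_add hA hB

/-! ### The two inputs of the engine and Kesten's inequality -/

/-- **The pattern inputs for the near family**: there are `a > 0`, `C`, `C'` and a threshold `k₀ ≥ 1` with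
(Ξ) `#{(m,ω) ∈ nearFam d k : J(ω) < a k} ≤ C |nearFam d k|/k³` for `k ≥ k₀`, and
(S) `3 |nearFam d (k+1)| · #{J = 0 in nearFam d (k+1)} / |nearFam d k|² ≤ C'/k` eventually.
[cite: MadrasSlade1993, Theorem 7.2.3; Theorem 7.3.2 (proof, (7.3.11)–(7.3.12))] -/
theorem nearFam_pattern_inputs (d : ℕ) : ∃ a C C' : ℝ, ∃ k₀ : ℕ, 0 < a ∧ 1 ≤ k₀ ∧
    (∀ k : ℕ, k₀ ≤ k →
      ((((nearFam d k).filter fun p => (vCount p.1 p.2 : ℝ) < a * k).card : ℝ)) ≤ C * (nearFam d k).card / (k : ℝ) ^ 3) ∧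
    (∀ᶠ k : ℕ in atTop,
      3 * ((nearFam d (k + 1)).card : ℝ) *
        (((nearFam d (k + 1)).filter fun p => ¬ 1 ≤ vCount p.1 p.2).card : ℝ) /
        ((nearFam d k).card : ℝ) ^ 2 ≤ C' / k) := by
  classical
  obtain ⟨q, hq, ε, hε0, hε1, N₀, hN₀⟩ := thm723 d
  obtain ⟨c, hc0, hlow⟩ := exists_lower_envelope d
  set μ := connectiveConstant (d + 2) with hμdef
  have hμ2 : 2 ≤ μ := le_trans (by norm_num) (natCast_le_connectiveConstant (d + 2))
  have hμ0 : 0 < μ := by linarith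
  have hr0 : 0 < 1 / μ := by positivity
  have hr1 : 1 / μ < 1 := by rw [div_lt_one hμ0]; linarith
  -- decay constants (`decay_bound`: `r^n n^0 e^{A√n} ≤ D`)
  obtain ⟨D₁, hD₁⟩ := decay_bound hr0 hr1 (16 + c) 0
  obtain ⟨D₂, hD₂⟩ := decay_bound (r := 1 - ε) (by linarith) (by linarith) (16 + c) 0
  obtain ⟨D₃, hD₃⟩ := decay_bound hr0 hr1 (27 + 2 * c) 0
  obtain ⟨D₄, hD₄⟩ := decay_bound (r := 1 - ε) (by linarith) (by linarith) (27 + 2 * c) 0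
  have hD0 : ∀ {r A D : ℝ}, (∀ n : ℕ, r ^ n * (n : ℝ) ^ 0 * Real.exp (A * Real.sqrt n) ≤ D) → 0 ≤ D := by
    intro r A D h
    have := h 0
    simp only [pow_zero, Nat.cast_zero, Real.sqrt_zero, mul_zero, Real.exp_zero, mul_one] at this
    linarith
  have hD₁0 := hD0 hD₁
  have hD₂0 := hD0 hD₂
  have hD₃0 := hD0 hD₃
  have hD₄0 := hD0 hD₄
  -- `(1/μ)^n e^{A√n} ≤ D` as `e^{A√n} ≤ D μ^n`
  have hmulμ : ∀ {A D : ℝ} (n : ℕ), (1 / μ) ^ n * (n : ℝ) ^ 0 * Real.exp (A * Real.sqrt n) ≤ D →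
      Real.exp (A * Real.sqrt n) ≤ D * μ ^ n := by
    intro A D n h
    rw [pow_zero, mul_one, one_div, inv_pow, inv_mul_le_iff₀ (pow_pos hμ0 n)] at h
    linarith
  refine ⟨1 / (2 * q), D₁ + D₂, 3 * μ ^ 4 * (D₃ + D₄), max N₀ 1, by positivity, le_max_right _ _, ?_, ?_⟩
  · -- (Ξ)
    intro k hk
    have hkN : N₀ ≤ k := le_trans (le_max_left _ _) hk
    have hk1 : 1 ≤ k := le_trans (le_max_right _ _) hk
    have hk0 : (0 : ℝ) < k := by exact_mod_cast hk1
    have hbad := card_poor_le_exp (d := d) hq hε0 hε1 hN₀ hkN hk1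
    have hW := hlow k hk1
    rw [le_div_iff₀ (by positivity)]
    set t := Real.sqrt (k : ℝ) with ht
    -- `k³ ≤ e^{6√k}`
    have hk3 : (k : ℝ) ^ 3 ≤ Real.exp (6 * t) := (natCast_pow_le_exp k 3).trans (le_of_eq (by rw [ht]; norm_num))
    have hD₁k : Real.exp ((16 + c) * t) ≤ D₁ * μ ^ k := hmulμ k (hD₁ k)
    have hD₂k : (1 - ε) ^ k * Real.exp ((16 + c) * t) ≤ D₂ := by
      have := hD₂ k; rw [pow_zero, mul_one] at this; exact this
    have hE : Real.exp (10 * t) * Real.exp (6 * t) = Real.exp ((16 + c) * t) * Real.exp (-(c * t)) := by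
      rw [← Real.exp_add, ← Real.exp_add]; ring_nf
    have hμ2k : μ ^ (2 * k) = μ ^ k * μ ^ k := by rw [two_mul, pow_add]
    have hpos1 : 0 ≤ Real.exp (-(c * t)) * μ ^ k := by positivity
    have hpos2 : 0 ≤ Real.exp (-(c * t)) * μ ^ (2 * k) := by positivity
    calc ((((nearFam d k).filter fun p => (vCount p.1 p.2 : ℝ) < 1 / (2 * q) * k).card : ℝ)) * (k : ℝ) ^ 3
        ≤ Real.exp (10 * t) * (μ ^ k + (1 - ε) ^ k * μ ^ (2 * k)) * Real.exp (6 * t) :=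
          mul_le_mul hbad hk3 (by positivity) (by positivity)
      _ = Real.exp ((16 + c) * t) * (Real.exp (-(c * t)) * μ ^ k) +
            (1 - ε) ^ k * Real.exp ((16 + c) * t) * (Real.exp (-(c * t)) * μ ^ (2 * k)) := by
          have : Real.exp (10 * t) * (μ ^ k + (1 - ε) ^ k * μ ^ (2 * k)) * Real.exp (6 * t) =
              (Real.exp (10 * t) * Real.exp (6 * t)) * (μ ^ k + (1 - ε) ^ k * μ ^ (2 * k)) := by ring
          rw [this, hE]; ring
      _ ≤ D₁ * μ ^ k * (Real.exp (-(c * t)) * μ ^ k) + D₂ * (Real.exp (-(c * t)) * μ ^ (2 * k)) :=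
          add_le_add (mul_le_mul_of_nonneg_right hD₁k hpos1) (mul_le_mul_of_nonneg_right hD₂k hpos2)
      _ = (D₁ + D₂) * (Real.exp (-(c * t)) * μ ^ (2 * k)) := by rw [hμ2k]; ring
      _ ≤ (D₁ + D₂) * (nearFam d k).card := mul_le_mul_of_nonneg_left hW (by positivity)
  · -- (S)
    filter_upwards [eventually_ge_atTop (max N₀ 1)] with k hk
    have hkN : N₀ ≤ k := le_trans (le_max_left _ _) hk
    have hk1 : 1 ≤ k := le_trans (le_max_right _ _) hk
    have hk0 : (0 : ℝ) < k := by exact_mod_cast hk1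
    set s := Real.sqrt ((k + 1 : ℕ) : ℝ) with hs
    have hZ : ((((nearFam d (k + 1)).filter fun p => ¬ 1 ≤ vCount p.1 p.2).card : ℝ)) ≤
        Real.exp (10 * s) * (μ ^ (k + 1) + (1 - ε) ^ (k + 1) * μ ^ (2 * (k + 1))) := by
      refine le_trans ?_ (card_poor_le_exp (d := d) hq hε0 hε1 hN₀ (by omega) (by omega))
      refine Nat.cast_le.2 (Finset.card_le_card fun p => ?_)
      simp only [Finset.mem_filter, not_le, Nat.lt_one_iff]
      rintro ⟨hp, hv⟩
      refine ⟨hp, ?_⟩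
      rw [hv, Nat.cast_zero]
      positivity
    have hS1 := card_nearFam_le_exp d (k + 1)
    rw [← hs] at hS1
    have hW := hlow k hk1
    have hWpos : (0 : ℝ) < (nearFam d k).card := by exact_mod_cast card_nearFam_pos hk1
    rw [div_le_div_iff₀ (by positivity) hk0]
    -- `e^{-2cs} μ^{4k} ≤ |W k|²`
    have hsk : Real.sqrt (k : ℝ) ≤ s := Real.sqrt_le_sqrt (by push_cast; linarith)
    have hW2 : Real.exp (-(2 * c * s)) * μ ^ (4 * k) ≤ ((nearFam d k).card : ℝ) ^ 2 := by
      have h1 : Real.exp (-(2 * c * s)) * μ ^ (4 * k) ≤ (Real.exp (-(c * Real.sqrt k)) * μ ^ (2 * k)) ^ 2 := by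
        rw [mul_pow, ← Real.exp_nat_mul, ← pow_mul, show 2 * k * 2 = 4 * k by ring]
        refine mul_le_mul_of_nonneg_right (Real.exp_le_exp.2 ?_) (by positivity)
        push_cast
        nlinarith [mul_le_mul_of_nonneg_left hsk hc0]
      exact h1.trans (pow_le_pow_left₀ (by positivity) hW 2)
    -- `k ≤ e^{2s}`
    have hk2 : (k : ℝ) ≤ Real.exp (2 * s) :=
      (le_exp_two_mul_sqrt (Nat.cast_nonneg k)).trans (Real.exp_le_exp.2 (by linarith))
    have hD₃k : Real.exp ((27 + 2 * c) * s) ≤ D₃ * μ ^ (k + 1) := hmulμ (k + 1) (hD₃ (k + 1))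
    have hD₄k : (1 - ε) ^ (k + 1) * Real.exp ((27 + 2 * c) * s) ≤ D₄ := by
      have := hD₄ (k + 1); rw [pow_zero, mul_one] at this; exact this
    have hE : Real.exp (15 * s) * Real.exp (10 * s) * Real.exp (2 * s) =
        Real.exp ((27 + 2 * c) * s) * Real.exp (-(2 * c * s)) := by
      rw [← Real.exp_add, ← Real.exp_add, ← Real.exp_add]; ring_nf
    have hP1 : μ ^ (k + 1) * (μ ^ (2 * (k + 1)) * μ ^ (k + 1)) = μ ^ 4 * μ ^ (4 * k) := by
      rw [← pow_add, ← pow_add, ← pow_add]; congr 1; ring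
    have hP2 : μ ^ (2 * (k + 1)) * μ ^ (2 * (k + 1)) = μ ^ 4 * μ ^ (4 * k) := by
      rw [← pow_add, ← pow_add]; congr 1; ring
    have hq1 : 0 ≤ Real.exp (-(2 * c * s)) * (μ ^ (2 * (k + 1)) * μ ^ (k + 1)) := by positivity
    have hq2 : 0 ≤ Real.exp (-(2 * c * s)) * (μ ^ 4 * μ ^ (4 * k)) := by positivity
    calc 3 * ((nearFam d (k + 1)).card : ℝ) *
          (((nearFam d (k + 1)).filter fun p => ¬ 1 ≤ vCount p.1 p.2).card : ℝ) * k
        ≤ 3 * (Real.exp (15 * s) * μ ^ (2 * (k + 1))) *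
            (Real.exp (10 * s) * (μ ^ (k + 1) + (1 - ε) ^ (k + 1) * μ ^ (2 * (k + 1)))) * Real.exp (2 * s) := by
          gcongr
      _ = 3 * (Real.exp (15 * s) * Real.exp (10 * s) * Real.exp (2 * s)) * (μ ^ (2 * (k + 1)) * μ ^ (k + 1)) +
            3 * (Real.exp (15 * s) * Real.exp (10 * s) * Real.exp (2 * s)) * (1 - ε) ^ (k + 1) *
              (μ ^ (2 * (k + 1)) * μ ^ (2 * (k + 1))) := by ring
      _ = 3 * (Real.exp ((27 + 2 * c) * s) * (Real.exp (-(2 * c * s)) * (μ ^ (2 * (k + 1)) * μ ^ (k + 1)))) +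
            3 * (((1 - ε) ^ (k + 1) * Real.exp ((27 + 2 * c) * s)) * (Real.exp (-(2 * c * s)) * (μ ^ 4 * μ ^ (4 * k)))) := by
          rw [hE, hP2]; ring
      _ ≤ 3 * (D₃ * μ ^ (k + 1) * (Real.exp (-(2 * c * s)) * (μ ^ (2 * (k + 1)) * μ ^ (k + 1)))) +
            3 * (D₄ * (Real.exp (-(2 * c * s)) * (μ ^ 4 * μ ^ (4 * k)))) := by
          gcongr
      _ = 3 * μ ^ 4 * (D₃ + D₄) * (Real.exp (-(2 * c * s)) * μ ^ (4 * k)) := by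
          have : D₃ * μ ^ (k + 1) * (Real.exp (-(2 * c * s)) * (μ ^ (2 * (k + 1)) * μ ^ (k + 1))) =
              D₃ * Real.exp (-(2 * c * s)) * (μ ^ (k + 1) * (μ ^ (2 * (k + 1)) * μ ^ (k + 1))) := by ring
          rw [this, hP1]; ring
      _ ≤ 3 * μ ^ 4 * (D₃ + D₄) * ((nearFam d k).card : ℝ) ^ 2 :=
          mul_le_mul_of_nonneg_left hW2 (by positivity)

/-- **Kesten's inequality (Madras–Slade (7.3.4)) for the near family**: with `ψ_k = |nearFam d (k+1)|/|nearFam d k|` there is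
`D` with `ψ_k² − D/k ≤ ψ_k ψ_{k+1}` for all large `k`. [cite: MadrasSlade1993, Theorem 7.3.2] -/
theorem nearFam_kesten_ineq (d : ℕ) : ∃ D : ℝ, ∀ᶠ k : ℕ in atTop,
    (((nearFam d (k + 1)).card : ℝ) / (nearFam d k).card) ^ 2 - D / k ≤
      (((nearFam d (k + 1)).card : ℝ) / (nearFam d k).card) *
        (((nearFam d (k + 2)).card : ℝ) / (nearFam d (k + 1)).card) := by
  obtain ⟨a, C, C', k₀, ha, hk₀, hPT, hS⟩ := nearFam_pattern_inputs d
  refine ⟨4 / a ^ 3 + 2 / a ^ 2 + 10 * C + C', ?_⟩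
  exact kesten_ineq_graded (S := nearFam d) k₀ (fun k p hp => length_lt_of_mem_nearFam hp)
    (fun _ hp hi => ins_mem_nearFam hp hi) (fun _ hp hi => del_mem_nearFam hp hi)
    (fun k hk => card_nearFam_pos (le_trans hk₀ hk)) ha (fun k hk _ => hPT k hk) hS

end Summit.CriticalPhenomena.PercolationContinuityZ3.Theorems.Pcint.MemoryTail
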